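import Summits.ResolutionOfSingularities.ResolutionOfSingularities.Theorems.PurelyInseparableDim4ScopeBlindRational
import HarnessLib

/-!
# Zoo certificate ‖ K — three MODE-1h FIXED POINTS at `(p,q) = (2,2)` reached from `d = 0` unit leaves, all BLIND
# (cell `res-dim4-pi`; unit-leaf tie-break census of res-dim4-p-10 g3, second engine res-dim4-eng-A g3, 2026-08-29 04:37Z;
# seat res-dim4-p-4 g3, «scope of the three fixed-point states: yours to say»)

[OURS · census certificate · counted 0 · AI kernel work, weaker than expert review.]  res-dim4-eng-A g3's second
engine on res-dim4-p-10 g3's unit-leaf MODE-1h census (leaves `x^a(1 + x₀)` over `𝔽₂`) located three PERIOD-1 MODE-1h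
cycles (K-A-01's species with period one), each a translated chart returning the state LETTER FOR LETTER:

* `fp1 = (x₀x₁² + x₀³ + x₀³x₁² = x₀·h², r = (x₀ ↦ 1), exc = {x₀})`, `h = x₀ + x₁ + x₀x₁`, reached from the leaf `2122`:
  MODE-1h centre `{x₀,x₁}` (the only one; `ord_{(x₀,x₁)} = 3`, so the new component books `3 − 2 = 1` on `x₀` — whence
  `r = (x₀ ↦ 1)` for the fixed point), chart `x₀`, fibre point `x₁ = 1`;
* `fp2 = (x₃x₁² + x₃x₀² + x₃x₀²x₁² = x₃·h², 0, {x₁})`, from the leaf `2113`: centre `{x₀,x₁}`, chart `x₁`, point `x₀ = 1`;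
* `fp3 = (x₃x₀ + x₃x₁ + x₃x₀x₁ = x₃·h, 0, {x₁})`, inside the tree of the leaf `1111`: centre `{x₀,x₁,x₃}`, chart `x₁`,
  point `x₀ = 1`.

This file certifies, by `decide` over `ZMod 2` in res-dim4-p-13's `StepKit` / `ScopeBlind` grammar: (i) each is a
`Step1h 2 s s` loop (`step1h_fp1/2/3`: MODE-1h centre, equimultiple translated point, cleaned child = the state letter for
letter, bookkeeping included); (ii) each is OUT OF COORDINATE SCOPE (`not_inCoordinateScope_fp1/2/3`): `J₂⁺ = (h²)`,
`(h²)`, `(h, x₃(1+x₁), x₃(1+x₀))` respectively, all killed by the rational curve `(t, t/(1+t), 0, 0) ⊂ V(h)` (in characteristic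
2, `h = 0 ⇔ x₁ = x₀/(1+x₀)`), witnesses `∂₀(fp1) = h²`, `∂₃(fp2) = h²`, `∂₃(fp3) = h` equal to `1` at `(1,1,0,0)` —
`ScopeBlind.rblindB`; so the three period-1 cycles are TIER-2 material (the regular non-coordinate hypersurface `V(h)`, resp.
surface `V(x₃, h)`, lies in the `2`-fold locus), like the coordinate cage, TRAP-1 and `…BlindFixedPoints`; (iii) headline
`exists_three_blind_mode1h_fixedPoints_two`.  Honest label: statements about OUR MODE-1h frame at three literal states,
`𝔽₂`-rational replies; `¬ Terminates1h 2 2` is K-A-01's and is not restated; nothing about F4-C(2,2); nothing here proves or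
refutes resolution of singularities in dimension `≥ 4` / characteristic `p`.
bears_on: LADDER-RESOLUTION:D157-DOOR2 (res-dim4-pi · unit-leaf census · MODE-1h fixed points ‖ K).  Supports
stmt-ResolutionOfSingularities-16155 (helper).
-/

-- house layout `Summits/<Summit>/<Problem>` doubles the namespace component (as in the Target file)
set_option linter.dupNamespace false

noncomputable section

open MvPolynomial Finset

namespace Summit.ResolutionOfSingularities.ResolutionOfSingularities.Theorems.PIDim4

namespace ZooCert.UnitLeafFP

open StepKit ScopeBlind
open Literature.AlgebraicGeometry.Resolution

/-! ## §1 The three states -/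

/-- `fp1 = (x₀x₁² + x₀³ + x₀³x₁², (x₀ ↦ 1), {x₀})` — from the unit leaf `x₀²x₁x₂²x₃²(1 + x₀)` (`2122`). [folklore] -/
def fp1 : SData 4 (ZMod 2) := ⟨[(![1, 2, 0, 0], 1), (![3, 0, 0, 0], 1), (![3, 2, 0, 0], 1)], ![1, 0, 0, 0], {0}⟩

/-- `fp2 = (x₁²x₃ + x₀²x₃ + x₀²x₁²x₃, 0, {x₁})` — from the unit leaf `x₀²x₁x₂x₃³(1 + x₀)` (`2113`). [folklore] -/
def fp2 : SData 4 (ZMod 2) := ⟨[(![0, 2, 0, 1], 1), (![2, 0, 0, 1], 1), (![2, 2, 0, 1], 1)], ![0, 0, 0, 0], {1}⟩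

/-- `fp3 = (x₀x₃ + x₁x₃ + x₀x₁x₃, 0, {x₁})` — inside the MODE-1h tree of the unit leaf `x₀x₁x₂x₃(1 + x₀)` (`1111`). [folklore] -/
def fp3 : SData 4 (ZMod 2) := ⟨[(![1, 0, 0, 1], 1), (![0, 1, 0, 1], 1), (![1, 1, 0, 1], 1)], ![0, 0, 0, 0], {1}⟩

/-! ## §2 Period-1 MODE-1h cycles, letter for letter -/

/-- **`fp1 → fp1` is a MODE-1h step**: centre `{x₀,x₁}` (the only least-cardinality permissible one), chart `x₀`, fibre point
`x₁ = 1`; books return (`x₀ ↦ 3 − 2 = 1`, `exc = {x₀}`). [folklore] -/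
theorem step1h_fp1 : Step1h 2 fp1.toState fp1.toState :=
  step1h_of {0, 1} 0 ![0, 1, 0, 0] (by decide) (by decide) (by decide) (by decide) (by decide) (by decide)

/-- **`fp2 → fp2` is a MODE-1h step**: centre `{x₀,x₁}`, chart `x₁`, fibre point `x₀ = 1`. [folklore] -/
theorem step1h_fp2 : Step1h 2 fp2.toState fp2.toState :=
  step1h_of {0, 1} 1 ![1, 0, 0, 0] (by decide) (by decide) (by decide) (by decide) (by decide) (by decide)

/-- **`fp3 → fp3` is a MODE-1h step**: centre `{x₀,x₁,x₃}`, chart `x₁`, fibre point `x₀ = 1`. [folklore] -/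
theorem step1h_fp3 : Step1h 2 fp3.toState fp3.toState :=
  step1h_of {0, 1, 3} 1 ![1, 0, 0, 0] (by decide) (by decide) (by decide) (by decide) (by decide) (by decide)

/-- The MODE-1h centre is unique at each of the three states. [folklore] -/
theorem mode1h_unique :
    (∀ S, IsMode1hCentre 2 S fp1.toState.F ↔ S = {0, 1}) ∧ (∀ S, IsMode1hCentre 2 S fp2.toState.F ↔ S = {0, 1}) ∧
      (∀ S, IsMode1hCentre 2 S fp3.toState.F ↔ S = {0, 1, 3}) := by
  refine ⟨fun S => ?_, fun S => ?_, fun S => ?_⟩ <;> rw [SData.toState_F, isMode1hCentre_iff] <;> revert S <;> decide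

/-! ## §3 All three are out of coordinate scope -/

/-- Blindness certificate for `fp1` along `(t, t/(1+t), 0, 0) ⊂ V(x₀ + x₁ + x₀x₁)`, witness `∂₀ = h²` at `(1,1,0,0)`. [folklore] -/
theorem rblindB_fp1 : rblindB 2 fp1 (monoP ![1, 1, 0, 0] ![1, 1, 0, 0]) ![0, 1, 0, 0] onePlusT ![1, 1, 0, 0]
    ![1, 0, 0, 0] ![1, 1, 0, 0] = true := by
  decide

/-- Blindness certificate for `fp2` (same curve), witness `∂₃ = h²` at `(1,1,0,0)`. [folklore] -/
theorem rblindB_fp2 : rblindB 2 fp2 (monoP ![1, 1, 0, 0] ![1, 1, 0, 0]) ![0, 1, 0, 0] onePlusT ![1, 1, 0, 0]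
    ![0, 0, 0, 1] ![1, 1, 0, 0] = true := by
  decide

/-- Blindness certificate for `fp3` (same curve), witness `∂₃ = h` at `(1,1,0,0)`. [folklore] -/
theorem rblindB_fp3 : rblindB 2 fp3 (monoP ![1, 1, 0, 0] ![1, 1, 0, 0]) ![0, 1, 0, 0] onePlusT ![1, 1, 0, 0]
    ![0, 0, 0, 1] ![1, 1, 0, 0] = true := by
  decide

/-- **`fp1` is OUT of coordinate scope** (`Sing₂ ⊇ V(x₀ + x₁ + x₀x₁)`, a regular non-coordinate hypersurface). [folklore] -/
theorem not_inCoordinateScope_fp1 : ¬ InCoordinateScope 2 fp1.toState.F := not_inCoordinateScope_of_rblindB rblindB_fp1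

/-- **`fp2` is OUT of coordinate scope** (`Sing₂ ⊇ V(x₀ + x₁ + x₀x₁)`). [folklore] -/
theorem not_inCoordinateScope_fp2 : ¬ InCoordinateScope 2 fp2.toState.F := not_inCoordinateScope_of_rblindB rblindB_fp2

/-- **`fp3` is OUT of coordinate scope** (`Sing₂ ⊇ V(x₃, x₀ + x₁ + x₀x₁)`, a regular non-coordinate surface). [folklore] -/
theorem not_inCoordinateScope_fp3 : ¬ InCoordinateScope 2 fp3.toState.F := not_inCoordinateScope_of_rblindB rblindB_fp3

end ZooCert.UnitLeafFP

open ZooCert.UnitLeafFP in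
/-- **Three blind period-1 MODE-1h cycles at `(2,2)` over `𝔽₂`** (eng-A g3's located fixed points of the unit-leaf census,
‖ K): each listed state `s` has `Step1h 2 s s` and `¬ InCoordinateScope 2 s.F`.  Census value; TIER-2; nothing about F4-C(2,2).
[folklore] -/
theorem exists_three_blind_mode1h_fixedPoints_two :
    ∀ s ∈ [fp1.toState, fp2.toState, fp3.toState], Step1h 2 s s ∧ ¬ InCoordinateScope 2 s.F := by
  intro s hs
  simp only [List.mem_cons, List.mem_nil_iff, or_false] at hs
  rcases hs with rfl | rfl | rfl
  · exact ⟨step1h_fp1, not_inCoordinateScope_fp1⟩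
  · exact ⟨step1h_fp2, not_inCoordinateScope_fp2⟩
  · exact ⟨step1h_fp3, not_inCoordinateScope_fp3⟩

end Summit.ResolutionOfSingularities.ResolutionOfSingularities.Theorems.PIDim4

end
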